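import Mathlib
import Literature.NumberTheory.Transcendental.KZCalculus
import Literature.NumberTheory.Transcendental.SemialgebraicMapsProofs
import Summits.KontsevichZagierPeriods.KontsevichZagierPeriods.Theorems.ScissorsTransportPolytopeTransportBox

/-!
# Polytope transport — two transports onto the same box give one change of variables

Helper file for `PolytopeTransport` (stmt-KontsevichZagierPeriods-10815, route ScissorsTransport).
If `A ⊆ P` and `B ⊆ Q` are full-measure subsets transported onto the SAME box (`Transport A V`,
`Transport B V`), then full-measure `ℚ`-semialgebraic subsets `A' ⊆ P`, `B' ⊆ Q` are source and
target of ONE instance of Kontsevich–Zagier's rule (2) with integrand `1`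
(`KZ.changeOfVariablesRel`, [Kontsevich–Zagier 2001, §1.2, rule (2)]): the composite
`Φ = Ψ_B⁻¹ ∘ Ψ_A` restricted to `A' = Ψ_A⁻¹(Ψ_A A ∩ Ψ_B B)`, a `ℚ`-semialgebraic injective map,
differentiable within `A'` with `|det Φ'| = 1` (chain rule, product of determinants); the discarded
sets are images of null sets under differentiable maps, hence null. Folklore bookkeeping around the
five fields of `changeOfVariablesRel`.
-/

noncomputable section

open Set MvPolynomial MeasureTheory
open Literature.NumberTheory.Transcendental
open Literature.ModelTheory.ExponentialFields (IsSemialgebraic)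

namespace Summit.KontsevichZagierPeriods.ScissorsTransport.PolytopeTransport

variable {n : ℕ}

/-- The representation `∫_σ 1` on a `ℚ`-semialgebraic set of finite volume.
[cite: KontsevichZagier2001, §1.1] -/
def oneRep {m : ℕ} (σ : Set (Fin m → ℝ)) (hσ : IsSemialgebraic ℚ σ) (hfin : volume σ ≠ ⊤) :
    KZ.IntegralRep m where
  domain := σ
  integrand := fun _ => 1
  isSemialgebraic_domain := hσ
  isSemialgebraicFunOn_integrand := (isSemialgebraicFunOn_aeval hσ (C 1)).congr fun x _ => by simp
  integrableOn := integrableOn_const hfin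

namespace Transport

variable {A B : Set (Fin (n + 1) → ℝ)} {V : ℚ}

/-- `Ψ ∘ Ψ⁻¹ = id` on the image. [folklore] -/
theorem right_inv (T : Transport A V) {y : Fin (n + 1) → ℝ} (hy : y ∈ T.toFun '' A) :
    T.toFun (T.invFun y) = y := by
  obtain ⟨x, hx, rfl⟩ := hy
  rw [T.left_inv x hx]

/-- `Ψ⁻¹` maps the image into `A`. [folklore] -/
theorem invFun_mem (T : Transport A V) {y : Fin (n + 1) → ℝ} (hy : y ∈ T.toFun '' A) :
    T.invFun y ∈ A := by
  obtain ⟨x, hx, rfl⟩ := hy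
  rwa [T.left_inv x hx]

/-- Images of null subsets of `Ψ '' A` under `Ψ⁻¹` are null. [folklore] -/
theorem volume_image_invFun_null (T : Transport A V) {N : Set (Fin (n + 1) → ℝ)}
    (hN : N ⊆ T.toFun '' A) (h0 : volume N = 0) : volume (T.invFun '' N) = 0 := by
  refine addHaar_image_eq_zero_of_differentiableOn_of_addHaar_eq_zero volume ?_ h0
  intro y hy
  exact ((T.hasFDerivWithinAt_inv y (hN hy)).mono hN).differentiableWithinAt

end Transport

/-- **Two transports onto the same box give one rule-(2) move** (the statement shape is that of
the route item `PolytopeTransport`; the move is Kontsevich–Zagier's rule (2)).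
[cite: KontsevichZagier2001, §1.2 rule (2)] -/
theorem exists_move_of_transport {A B P Q : Set (Fin (n + 1) → ℝ)} {V : ℚ}
    (TA : Transport A V) (TB : Transport B V) (hAP : A ⊆ P) (hBQ : B ⊆ Q)
    (hPA : volume (P \ A) = 0) (hQB : volume (Q \ B) = 0) (hP : volume P ≠ ⊤) (hQ : volume Q ≠ ⊤) :
    ∃ (s s' : KZ.IntegralRep (n + 1)), s.domain ⊆ P ∧ volume (P \ s.domain) = 0 ∧
      s'.domain ⊆ Q ∧ volume (Q \ s'.domain) = 0 ∧ (∀ z ∈ s.domain, s.integrand z = 1) ∧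
      (∀ z ∈ s'.domain, s'.integrand z = 1) ∧ KZ.of s - KZ.of s' ∈ KZ.changeOfVariablesRel := by
  -- the common part of the two images and its pull-backs
  set M := TA.toFun '' A ∩ TB.toFun '' B with hM_def
  set A' := TA.invFun '' M with hA'_def
  set B' := TB.invFun '' M with hB'_def
  have hIA : IsSemialgebraic ℚ (TA.toFun '' A) :=
    IsSemialgebraicMapOn.isSemialgebraic_image_holds TA.sa Subset.rfl TA.sa_set
  have hIB : IsSemialgebraic ℚ (TB.toFun '' B) :=
    IsSemialgebraicMapOn.isSemialgebraic_image_holds TB.sa Subset.rfl TB.sa_set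
  have hM : IsSemialgebraic ℚ M := hIA.inter hIB
  have hA'sa : IsSemialgebraic ℚ A' :=
    IsSemialgebraicMapOn.isSemialgebraic_image_holds TA.sa_inv inter_subset_left hM
  have hB'sa : IsSemialgebraic ℚ B' :=
    IsSemialgebraicMapOn.isSemialgebraic_image_holds TB.sa_inv inter_subset_right hM
  have hA'A : A' ⊆ A := by
    rintro _ ⟨y, hy, rfl⟩; exact TA.invFun_mem hy.1
  have hB'B : B' ⊆ B := by
    rintro _ ⟨y, hy, rfl⟩; exact TB.invFun_mem hy.2
  -- the lost parts are null
  have hAA' : volume (A \ A') = 0 := by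
    have hsub : A \ A' ⊆ TA.invFun '' (TA.toFun '' A \ M) := by
      rintro x ⟨hx, hx'⟩
      refine ⟨TA.toFun x, ⟨⟨x, hx, rfl⟩, fun hm => hx' ⟨TA.toFun x, hm, TA.left_inv x hx⟩⟩,
        TA.left_inv x hx⟩
    refine measure_mono_null hsub (TA.volume_image_invFun_null Set.sdiff_subset ?_)
    refine measure_mono_null ?_ TB.null
    rintro y ⟨hy, hyM⟩
    exact ⟨TA.image_subset hy, fun h => hyM ⟨hy, h⟩⟩
  have hBB' : volume (B \ B') = 0 := by
    have hsub : B \ B' ⊆ TB.invFun '' (TB.toFun '' B \ M) := by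
      rintro x ⟨hx, hx'⟩
      refine ⟨TB.toFun x, ⟨⟨x, hx, rfl⟩, fun hm => hx' ⟨TB.toFun x, hm, TB.left_inv x hx⟩⟩,
        TB.left_inv x hx⟩
    refine measure_mono_null hsub (TB.volume_image_invFun_null Set.sdiff_subset ?_)
    refine measure_mono_null ?_ TA.null
    rintro y ⟨hy, hyM⟩
    exact ⟨TB.image_subset hy, fun h => hyM ⟨h, hy⟩⟩
  have hPA' : volume (P \ A') = 0 := by
    refine measure_mono_null (fun x hx => ?_) (measure_union_null hPA hAA')
    by_cases hxA : x ∈ A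
    · exact Or.inr ⟨hxA, hx.2⟩
    · exact Or.inl ⟨hx.1, hxA⟩
  have hQB' : volume (Q \ B') = 0 := by
    refine measure_mono_null (fun x hx => ?_) (measure_union_null hQB hBB')
    by_cases hxB : x ∈ B
    · exact Or.inr ⟨hxB, hx.2⟩
    · exact Or.inl ⟨hx.1, hxB⟩
  -- the map
  set Φ : (Fin (n + 1) → ℝ) → (Fin (n + 1) → ℝ) := fun x => TB.invFun (TA.toFun x) with hΦ_def
  set Φ' : (Fin (n + 1) → ℝ) → (Fin (n + 1) → ℝ) →L[ℝ] (Fin (n + 1) → ℝ) :=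
    fun x => (TB.derivInv (TA.toFun x)).comp (TA.deriv x) with hΦ'_def
  have hTA_A' : ∀ x ∈ A', TA.toFun x ∈ M := by
    rintro _ ⟨y, hy, rfl⟩
    rwa [TA.right_inv hy.1]
  have hmaps : MapsTo TA.toFun A' (TB.toFun '' B) := fun x hx => (hTA_A' x hx).2
  have himg : Φ '' A' = B' := by
    apply Subset.antisymm
    · rintro _ ⟨x, hx, rfl⟩
      exact ⟨TA.toFun x, hTA_A' x hx, rfl⟩
    · rintro _ ⟨y, hy, rfl⟩
      refine ⟨TA.invFun y, ⟨y, hy, rfl⟩, ?_⟩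
      simp only [hΦ_def, TA.right_inv hy.1]
  have hvolA' : volume A' ≠ ⊤ := (measure_mono (hA'A.trans hAP)).trans_lt hP.lt_top |>.ne
  have hvolB' : volume B' ≠ ⊤ := (measure_mono (hB'B.trans hBQ)).trans_lt hQ.lt_top |>.ne
  refine ⟨oneRep A' hA'sa hvolA', oneRep B' hB'sa hvolB', hA'A.trans hAP, hPA', hB'B.trans hBQ, hQB',
    fun _ _ => rfl, fun _ _ => rfl, ?_⟩
  refine ⟨n + 1, oneRep A' hA'sa hvolA', oneRep B' hB'sa hvolB', Φ, Φ', ?_, ?_, ?_, himg.symm, ?_, rfl⟩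
  · -- semialgebraic
    exact IsSemialgebraicMapOn.comp_holds TB.sa_inv (TA.sa.mono hA'A hA'sa) hmaps
  · -- derivative within `A'`
    intro x hx
    have h1 : HasFDerivWithinAt TA.toFun (TA.deriv x) A' x := (TA.hasFDerivWithinAt x (hA'A hx)).mono hA'A
    have h2 : HasFDerivWithinAt TB.invFun (TB.derivInv (TA.toFun x)) (TB.toFun '' B) (TA.toFun x) :=
      TB.hasFDerivWithinAt_inv _ (hmaps hx)
    exact h2.comp x h1 hmaps
  · -- injective
    intro x₁ h₁ x₂ h₂ h
    have h' : TB.toFun (TB.invFun (TA.toFun x₁)) = TB.toFun (TB.invFun (TA.toFun x₂)) := by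
      simp only [hΦ_def] at h
      rw [h]
    rw [TB.right_inv (hmaps h₁), TB.right_inv (hmaps h₂)] at h'
    have := congrArg TA.invFun h'
    rwa [TA.left_inv x₁ (hA'A h₁), TA.left_inv x₂ (hA'A h₂)] at this
  · -- integrand `1 = 1 · |det|`
    intro x hx
    change (1 : ℝ) = 1 * |(Φ' x).det|
    rw [hΦ'_def, det_comp, abs_mul, TB.abs_det_inv _ (hmaps hx), TA.abs_det x (hA'A hx)]
    norm_num

end Summit.KontsevichZagierPeriods.ScissorsTransport.PolytopeTransport
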